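import Mathlib
import HarnessLib
import Summits.HubbardSuperconductivity.HubbardSuperconductivity.Theorems.KLProgrammeKLRegimeTorusL1DyadicSuperpositionWt
import Summits.HubbardSuperconductivity.HubbardSuperconductivity.Theorems.KLProgrammeKLRegimeEngineTowerImportP2PlainFromValues
import Summits.HubbardSuperconductivity.HubbardSuperconductivity.Theorems.KLProgrammeKLRegimeEngineScaleWtSliceRows

/-!
# Route `KLProgramme` — crux K3 ENGINE (stmt-HubbardSuperconductivity-20437 `KLRegimeEngineV17F2`), stub (b) closing path, E1 rows E-b2(4) (the
# `klScaleWt_j`-WEIGHTED plain four-leg cell) / E-b3: the WEIGHTED PLAIN FOUR-LEG LINE FROM A MOMENTUM-SPACE DYADIC REPRESENTATION of the quartic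
# kernel — weighted twin of `…TowerImportP2PlainFromValues` (T2), EVERY pinned leg

Cell gate-hubbard-kl, seat hubbard-kl-k3c2-p3 (g17; row «sector-counting import»), brick (T2w) of «WT-NORM-BRICK» (KL STATUS 2026-08-29 10:4xZ).
(T2) turned a representation `W = Σ_i a_i·B_i + R` of a four-leg position kernel by pair-transfer bumps (`B_i` majorised by
`[x₁ = x₀][x₃ = x₂]·c·|Σ_q χ_q(x₀ − x₂) G_i(q)|`) into the PLAIN pinned line `≤ ε³·c·√(C·n₀)·(2M·L²)·Σ‖a_i‖A_i + line(R)`.  The W-assembly's four-leg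
CELL (W12♯3 ll.185–191) and the tower's four-leg IMPORTS read the same line with the tree weight `klScaleWt_j` of the four leg positions inside, at EVERY
pinned leg `q`.  On a pair-transfer term the four positions collapse to the pair `{x₀, x₂}`, whose weight is the one-moment weight of `x₀ − x₂` at rates
`(Λ_jβ/(2M), Λ_j)` (`klScaleWt_pair_latticeLegPos_le`); a bump at a scale `i ≤ j` (rates ABOVE those) pays that moment with `O(1)` ((T1w)
`sum_wt_norm_charSum_bump_le`).  So the weighted line costs the same dyadic total variation as the plain one:

* §1 `klScaleWt_mono` (the tree weight is monotone in the position set), `image_pairForced_subset`, `sum_filter_pairForced_le` (at ANY pinned leg `q` the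
  pair-forced sum is at most the two one-pin sums);
* §2 **`wtPinnedSum_le_of_pairTransfer`** — `ε³·Σ_{x : x q = y} klScaleWt_j(pos x)·‖B Ω x‖ ≤ ε³·(2c)·Σ_z m_j(z)·|Σ_q χ_q(z) G(q)|`, `m_j` the one-moment weight;
* §3 **`wtPinnedSum_le_of_pairTransfer_bump`** — with (T1w)-bump data (sup `A`, support `≤ n₀(s₀·2M)(s₁L)²`, time/axis THIRD differences, rates
  `s₀ ≥ Λ_jβ/(2M)`, `s₁ ≥ Λ_j`, `≤ 1`): `≤ ε³·(2c)·√(6561988608·n₀)·(2M·L²)·A`;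
* §4 `wtPinnedSum_le_of_superposition`, **`wtPinnedSum_le_of_pairTransfer_superposition`** — `W = Σ a_i B_i + R` ⇒
  `≤ ε³·(2c)·√(6561988608·n₀)·(2M·L²)·Σ‖a_i‖A_i + (weighted pinned sum of R)`;
* §5 **`wplainFourLegLine_of_pairTransfer_superposition`** — the CELL / IMPORT shape: for a Grassmann `𝒱` whose trivial-family quartic kernel has such a
  representation for every label string, with `Σ‖a_i‖A_i ≤ V`, weighted remainder lines `≤ r` and `ε³·(2c)·(2M·L²) ≤ κ`:
  `∀ q τ′ y′, ε³·Σ_{x′ : x′ q = y′} klScaleWt_j(pos x′)·‖sectorisedKernel … trivialMultiplier 𝒱 4 τ′ x′‖ ≤ κ·√(6561988608·n₀)·V + r` — the `S₄ j` / `s₄` binder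
  of the weighted assemblies, from the SAME data as the (X).1 plain line plus third differences and the scale ordering `i ≤ j`.
Everything is proved; no definitions; the representation stays a hypothesis (E1); nothing asserts any stub, K3 or superconductivity.
References: BGM 2006 §2.3 (2.17), §2.8 (2.81), §3 (3.65) [cite: BenfattoGiulianiMastropietro2006]; Katznelson, *Harmonic Analysis* Ch. I §6.
-/

noncomputable section

namespace Summit.HubbardSuperconductivity.HubbardSuperconductivity.Theorems.EngineV8

set_option linter.dupNamespace false -- summit = problem name (single-conjunct summit), D-0017

open Classical
open Finset Literature.MathematicalPhysics.QuantumLattice Literature.Probability.LatticeModels Literature.Probability.LatticeModels.BattleFederbush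
open Summit.HubbardSuperconductivity.HubbardSuperconductivity.Theorems.TorusFourierL2
open Summit.HubbardSuperconductivity.HubbardSuperconductivity.Theorems.KLProgrammeLegKernels
open Summit.HubbardSuperconductivity.HubbardSuperconductivity.Theorems.DispersionFlow
open Summit.HubbardSuperconductivity.HubbardSuperconductivity.Theorems.KLRegimeSplit

variable {L M : ℕ} [NeZero L] [NeZero M]

/-! ### §1 Weight monotonicity and the pair-forced sum at any pinned leg -/

omit [NeZero L] [NeZero M] in
/-- The tree weight `klScaleWt` is monotone in the position set. [folklore] -/
theorem klScaleWt_mono (β : ℝ) (n : ℕ) {S T : Finset (ZMod (2 * (2 * M)) × TorusSite 2 L)} (hST : S ⊆ T) :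
    klScaleWt L M β n S ≤ klScaleWt L M β n T := by
  rw [klScaleWt_apply, klScaleWt_apply]
  have hΛ : 0 ≤ klScale klE0 n := (klth_klScale_pos n).le
  have := labelDiam_mono (gridLabelDist L (2 * (2 * M)) β) hST
  have h := mul_le_mul_of_nonneg_left this hΛ
  linarith

omit [NeZero L] [NeZero M] in
/-- On a pair-forced 4-tuple (`x₁ = x₀`, `x₃ = x₂`) the image of the positions under any map lies in the pair `{g x₀, g x₂}`. [folklore] -/
theorem image_pairForced_subset {Γ Λ : Type*} [DecidableEq Γ] [DecidableEq Λ] (g : Γ → Λ) (x : Fin 4 → Γ) (h : x 1 = x 0 ∧ x 3 = x 2) :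
    (univ.image x).image g ⊆ {g (x 0), g (x 2)} := by
  intro a ha
  simp only [mem_image, mem_univ, true_and] at ha
  obtain ⟨b, ⟨i, rfl⟩, rfl⟩ := ha
  simp only [mem_insert, mem_singleton]
  match i with
  | 0 => exact Or.inl rfl
  | 1 => exact Or.inl (by rw [h.1])
  | 2 => exact Or.inr rfl
  | 3 => exact Or.inr (by rw [h.2])

omit [NeZero L] [NeZero M] in
/-- **The pair-forced sum at ANY pinned leg is at most the two one-pin sums**: for `g ≥ 0`,
`Σ_{x : x q = y} [x₁ = x₀ ∧ x₃ = x₂]·g(x₀, x₂) ≤ Σ_w g(y, w) + Σ_u g(u, y)`. [folklore] -/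
theorem sum_filter_pairForced_le {Γ : Type*} [Fintype Γ] [DecidableEq Γ] (g : Γ → Γ → ℝ) (hg : ∀ u w, 0 ≤ g u w) (q : Fin 4) (y : Γ) :
    ∑ x ∈ univ.filter (fun x : Fin 4 → Γ => x q = y), (if x 1 = x 0 ∧ x 3 = x 2 then g (x 0) (x 2) else 0) ≤
      ∑ w, g y w + ∑ u, g u y := by
  rw [← sum_filter]
  set S := (univ.filter (fun x : Fin 4 → Γ => x q = y)).filter (fun x => x 1 = x 0 ∧ x 3 = x 2) with hS
  set π : (Fin 4 → Γ) → Γ × Γ := fun x => (x 0, x 2) with hπ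
  have hinj : Set.InjOn π S := by
    intro x hx x' hx' hxx
    simp only [hS, coe_filter, mem_filter, mem_univ, true_and, Set.mem_setOf_eq] at hx hx'
    simp only [hπ, Prod.mk.injEq] at hxx
    funext i
    fin_cases i
    · exact hxx.1
    · show x 1 = x' 1; rw [hx.2.1, hx'.2.1, hxx.1]
    · exact hxx.2
    · show x 3 = x' 3; rw [hx.2.2, hx'.2.2, hxx.2]
  have himg : ∑ x ∈ S, g (x 0) (x 2) = ∑ p ∈ S.image π, g p.1 p.2 := by
    rw [sum_image hinj]
  rw [himg]
  set A := (univ : Finset (Γ × Γ)).filter (fun p => p.1 = y) with hA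
  set B := (univ : Finset (Γ × Γ)).filter (fun p => p.2 = y) with hB
  have hsub : S.image π ⊆ A ∪ B := by
    intro p hp
    rw [mem_image] at hp
    obtain ⟨x, hx, rfl⟩ := hp
    simp only [hS, mem_filter, mem_univ, true_and] at hx
    obtain ⟨hq, h10, h32⟩ := hx
    simp only [mem_union, hA, hB, mem_filter, mem_univ, true_and, hπ]
    fin_cases q
    · exact Or.inl hq
    · exact Or.inl (by rw [← h10]; exact hq)
    · exact Or.inr hq
    · exact Or.inr (by rw [← h32]; exact hq)
  have hnonneg : ∀ p ∈ A ∪ B, p ∉ S.image π → 0 ≤ g p.1 p.2 := fun p _ _ => hg _ _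
  refine (sum_le_sum_of_subset_of_nonneg hsub hnonneg).trans ?_
  have hunion : ∑ p ∈ A ∪ B, g p.1 p.2 ≤ ∑ p ∈ A, g p.1 p.2 + ∑ p ∈ B, g p.1 p.2 := by
    rw [← sum_union_inter]
    have : 0 ≤ ∑ p ∈ A ∩ B, g p.1 p.2 := sum_nonneg fun p _ => hg _ _
    linarith
  refine hunion.trans (le_of_eq ?_)
  have hAsum : ∑ p ∈ A, g p.1 p.2 = ∑ w, g y w := by
    rw [hA, sum_filter, Fintype.sum_prod_type]
    simp only
    rw [Finset.sum_eq_single y (fun u _ hu => by simp [hu]) (fun h => absurd (mem_univ y) h)]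
    simp
  have hBsum : ∑ p ∈ B, g p.1 p.2 = ∑ u, g u y := by
    rw [hB, sum_filter, Fintype.sum_prod_type]
    simp only
    refine sum_congr rfl fun u _ => ?_
    rw [Finset.sum_eq_single y (fun w _ hw => by simp [hw]) (fun h => absurd (mem_univ y) h)]
    simp
  rw [hAsum, hBsum]

/-! ### §2 Pair-transfer forms under the tree weight, any pinned leg -/

/-- **THE WEIGHTED PINNED SUM OF A PAIR-TRANSFER FORM, ANY PINNED LEG** (`0 ≤ β`, `0 ≤ c`): if
`‖B Ω x‖ ≤ [x₁ = x₀][x₃ = x₂]·c·‖Σ_q χ_{q₁}((x₀)₀ − (x₂)₀)χ_{q₂}(x⃗₀ − x⃗₂)•G(q)‖`, then for every pinned leg `q` and pin `y`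
`ε³·Σ_{x : x q = y} klScaleWt_j(pos x)·‖B Ω x‖ ≤ ε³·(2c)·Σ_z (1 + (Λ_jβ/(2M))|z̃₁| + Λ_j|z̃₂,₁| + Λ_j|z̃₂,₂|)·‖Σ_q χ_q(z)•G(q)‖` — the four positions collapse to
the pair `{x₀, x₂}`, whose tree weight is the one-moment weight of the difference (`klScaleWt_pair_latticeLegPos_le`).
[cite: BenfattoGiulianiMastropietro2006, §2.3 (2.17), §2.8 (2.81)] -/
theorem wtPinnedSum_le_of_pairTransfer {N : ℕ} {β : ℝ} (hβ : 0 ≤ β) (B : (Fin 4 → SectorLeg N) → (Fin 4 → SpaceTimeIdx L M) → ℂ)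
    (Ω : Fin 4 → SectorLeg N) (G : TorusSite 1 (2 * M) × TorusSite 2 L → ℂ) {c : ℝ} (hc : 0 ≤ c)
    (hB : ∀ x : Fin 4 → SpaceTimeIdx L M, ‖B Ω x‖ ≤
      if x 1 = x 0 ∧ x 3 = x 2 then c * ‖∑ q : TorusSite 1 (2 * M) × TorusSite 2 L,
        (torusChar q.1 (fun _ : Fin 1 => (((x 0).1 : ℕ) : ZMod (2 * M)) - (((x 2).1 : ℕ) : ZMod (2 * M))) *
          torusChar q.2 ((x 0).2 - (x 2).2)) • G q‖ else 0) (j : ℕ) (q : Fin 4) (y : SpaceTimeIdx L M) :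
    imagTimeWeight β M ^ 3 *
        ∑ x ∈ univ.filter (fun x : Fin 4 → SpaceTimeIdx L M => x q = y),
          klScaleWt L M β j ((univ.image x).image (fun x : SpaceTimeIdx L M => (((((2 * (x.1 : ℕ) : ℕ)) : ZMod (2 * (2 * M)))), x.2))) *
            ‖B Ω x‖ ≤
      imagTimeWeight β M ^ 3 * (2 * c *
        ∑ z : TorusSite 1 (2 * M) × TorusSite 2 L,
          (1 + klScale klE0 j * β / (2 * M) * |(((z.1 0).valMinAbs : ℤ) : ℝ)| + klScale klE0 j * |(((z.2 0).valMinAbs : ℤ) : ℝ)| +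
              klScale klE0 j * |(((z.2 1).valMinAbs : ℤ) : ℝ)|) *
            ‖∑ q : TorusSite 1 (2 * M) × TorusSite 2 L, (torusChar q.1 z.1 * torusChar q.2 z.2) • G q‖) := by
  classical
  set gpos : SpaceTimeIdx L M → ZMod (2 * (2 * M)) × TorusSite 2 L :=
    fun x => (((((2 * (x.1 : ℕ) : ℕ)) : ZMod (2 * (2 * M)))), x.2) with hgpos
  set CS : TorusSite 1 (2 * M) × TorusSite 2 L → ℝ := fun z =>
    ‖∑ q : TorusSite 1 (2 * M) × TorusSite 2 L, (torusChar q.1 z.1 * torusChar q.2 z.2) • G q‖ with hCS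
  set mw : TorusSite 1 (2 * M) × TorusSite 2 L → ℝ := fun z =>
    1 + klScale klE0 j * β / (2 * M) * |(((z.1 0).valMinAbs : ℤ) : ℝ)| + klScale klE0 j * |(((z.2 0).valMinAbs : ℤ) : ℝ)| +
      klScale klE0 j * |(((z.2 1).valMinAbs : ℤ) : ℝ)| with hmw
  set D : SpaceTimeIdx L M → SpaceTimeIdx L M → TorusSite 1 (2 * M) × TorusSite 2 L := fun u v =>
    ((fun _ : Fin 1 => ((u.1 : ℕ) : ZMod (2 * M)) - ((v.1 : ℕ) : ZMod (2 * M))), u.2 - v.2) with hD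
  have hΛ : 0 ≤ klScale klE0 j := (klth_klScale_pos j).le
  have hM0 : (0 : ℝ) < M := by exact_mod_cast Nat.pos_of_ne_zero (NeZero.ne M)
  have hmw0 : ∀ z, 0 ≤ mw z := fun z => by rw [hmw]; positivity
  have hCS0 : ∀ z, 0 ≤ CS z := fun z => norm_nonneg _
  have hB' : ∀ x : Fin 4 → SpaceTimeIdx L M, ‖B Ω x‖ ≤ if x 1 = x 0 ∧ x 3 = x 2 then c * CS (D (x 0) (x 2)) else 0 := by
    intro x; simpa [hCS, hD] using hB x
  -- on a forced tuple the weight is the pair weight, below the moment weight of the difference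
  have hwt : ∀ x : Fin 4 → SpaceTimeIdx L M, x 1 = x 0 ∧ x 3 = x 2 →
      klScaleWt L M β j ((univ.image x).image gpos) ≤ mw (D (x 0) (x 2)) := by
    intro x hx
    have hsub := image_pairForced_subset gpos x hx
    have hpair : ({gpos (x 0), gpos (x 2)} : Finset (ZMod (2 * (2 * M)) × TorusSite 2 L)) =
        {latticeLegPos (2 * (2 * M)) ((x 0, Ω 0) : SpaceTimeIdx L M × SectorLeg N),
          latticeLegPos (2 * (2 * M)) ((x 2, Ω 0) : SpaceTimeIdx L M × SectorLeg N)} := rfl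
    refine (klScaleWt_mono β j hsub).trans ?_
    rw [hpair]
    refine (klScaleWt_pair_latticeLegPos_le hβ j _ _).trans (le_of_eq ?_)
    simp [hmw, hD]
  -- termwise majorant
  have hpt : ∀ x : Fin 4 → SpaceTimeIdx L M,
      klScaleWt L M β j ((univ.image x).image gpos) * ‖B Ω x‖ ≤
        if x 1 = x 0 ∧ x 3 = x 2 then c * (mw (D (x 0) (x 2)) * CS (D (x 0) (x 2))) else 0 := by
    intro x
    have hw1 : 1 ≤ klScaleWt L M β j ((univ.image x).image gpos) := one_le_klScaleWt L M β j _
    by_cases hx : x 1 = x 0 ∧ x 3 = x 2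
    · rw [if_pos hx]
      have hBx : ‖B Ω x‖ ≤ c * CS (D (x 0) (x 2)) := by simpa [hx] using hB' x
      calc klScaleWt L M β j ((univ.image x).image gpos) * ‖B Ω x‖
          ≤ mw (D (x 0) (x 2)) * (c * CS (D (x 0) (x 2))) :=
            mul_le_mul (hwt x hx) hBx (norm_nonneg _) (hmw0 _)
        _ = c * (mw (D (x 0) (x 2)) * CS (D (x 0) (x 2))) := by ring
    · rw [if_neg hx]
      have hBx : ‖B Ω x‖ ≤ 0 := by simpa [hx] using hB' x
      have hB0 : ‖B Ω x‖ = 0 := le_antisymm hBx (norm_nonneg _)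
      rw [hB0, mul_zero]
  refine mul_le_mul_of_nonneg_left ?_ (pow_nonneg (imagTimeWeight_nonneg hβ M) 3)
  calc ∑ x ∈ univ.filter (fun x : Fin 4 → SpaceTimeIdx L M => x q = y), klScaleWt L M β j ((univ.image x).image gpos) * ‖B Ω x‖
      ≤ ∑ x ∈ univ.filter (fun x : Fin 4 → SpaceTimeIdx L M => x q = y),
          (if x 1 = x 0 ∧ x 3 = x 2 then (fun u w => c * (mw (D u w) * CS (D u w))) (x 0) (x 2) else 0) :=
        sum_le_sum fun x _ => hpt x
    _ ≤ ∑ w, c * (mw (D y w) * CS (D y w)) + ∑ u, c * (mw (D u y) * CS (D u y)) :=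
        sum_filter_pairForced_le (fun u w => c * (mw (D u w) * CS (D u w)))
          (fun u w => mul_nonneg hc (mul_nonneg (hmw0 _) (hCS0 _))) q y
    _ = c * ∑ z, mw z * CS z + c * ∑ z, mw z * CS z := by
        rw [← mul_sum, ← mul_sum]
        congr 1
        · exact congrArg (c * ·) (sum_spaceTime_eq_sum_prodTorus (fun z => mw z * CS z) y)
        · exact congrArg (c * ·) (sum_spaceTime_eq_sum_prodTorus_rev (fun z => mw z * CS z) y)
    _ = 2 * c * ∑ z, mw z * CS z := by ring

/-! ### §3 Pair-transfer BUMPS finer than the weight: the scale-free bound -/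

/-- **A pair-transfer bump FINER than the weight has weighted pinned sum `O(ε³·c·2M·L²·A)` at every pinned leg**: under the majorant of
`wtPinnedSum_le_of_pairTransfer` with a symbol `G` that is a bump of rates `(s₀, s₁) ∈ (0,1]²` on `(ℤ/2M)¹ × (ℤ/L)²` dominating the weight's rates
(`Λ_jβ/(2M) ≤ s₀`, `Λ_j ≤ s₁`), support `≤ n₀(s₀·2M)(s₁L)²`, sup `≤ A`, time/axis THIRD differences `≤ A(4/(s₀·2M))³`, `≤ A(4/(s₁L))³`:
`ε³·Σ_{x : x q = y} klScaleWt_j(pos x)‖B Ω x‖ ≤ ε³·(2c)·√(6561988608·n₀)·(2M·L²)·A`. [cite: BenfattoGiulianiMastropietro2006, §2.8 (2.81)] -/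
theorem wtPinnedSum_le_of_pairTransfer_bump {N : ℕ} {β : ℝ} (hβ : 0 ≤ β) (B : (Fin 4 → SectorLeg N) → (Fin 4 → SpaceTimeIdx L M) → ℂ)
    (Ω : Fin 4 → SectorLeg N) (G : TorusSite 1 (2 * M) × TorusSite 2 L → ℂ) {c : ℝ} (hc : 0 ≤ c)
    (hB : ∀ x : Fin 4 → SpaceTimeIdx L M, ‖B Ω x‖ ≤
      if x 1 = x 0 ∧ x 3 = x 2 then c * ‖∑ q : TorusSite 1 (2 * M) × TorusSite 2 L,
        (torusChar q.1 (fun _ : Fin 1 => (((x 0).1 : ℕ) : ZMod (2 * M)) - (((x 2).1 : ℕ) : ZMod (2 * M))) *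
          torusChar q.2 ((x 0).2 - (x 2).2)) • G q‖ else 0)
    (j : ℕ) {s₀ s₁ : ℝ} (hs₀ : 0 < s₀) (hs₀1 : s₀ ≤ 1) (hs₁ : 0 < s₁) (hs₁1 : s₁ ≤ 1)
    (hts₀ : klScale klE0 j * β / (2 * M) ≤ s₀) (hts₁ : klScale klE0 j ≤ s₁) {A : ℝ} (hA : 0 ≤ A) {Ns : ℕ} {n₀ : ℝ}
    (hn₀ : 0 ≤ n₀) (hNs : (Ns : ℝ) ≤ n₀ * (s₀ * (2 * M : ℕ)) * (s₁ * L) ^ 2)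
    (hsupp : (univ.filter fun q => G q ≠ 0).card ≤ Ns) (hsup : ∀ q, ‖G q‖ ≤ A)
    (h₀ : ∀ q, ‖(fwdDiff ((fun _ : Fin 1 => (1 : ZMod (2 * M))), (0 : TorusSite 2 L)))^[3] G q‖ ≤ A * (4 / (s₀ * (2 * M : ℕ))) ^ 3)
    (h₁ : ∀ q (i : Fin 2), ‖(fwdDiff ((0 : TorusSite 1 (2 * M)), (Pi.single i (1 : ZMod L) : TorusSite 2 L)))^[3] G q‖ ≤
      A * (4 / (s₁ * L)) ^ 3) (q : Fin 4) (y : SpaceTimeIdx L M) :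
    imagTimeWeight β M ^ 3 *
        ∑ x ∈ univ.filter (fun x : Fin 4 → SpaceTimeIdx L M => x q = y),
          klScaleWt L M β j ((univ.image x).image (fun x : SpaceTimeIdx L M => (((((2 * (x.1 : ℕ) : ℕ)) : ZMod (2 * (2 * M)))), x.2))) *
            ‖B Ω x‖ ≤
      imagTimeWeight β M ^ 3 * (2 * c * (Real.sqrt (6561988608 * n₀) * (((2 * M : ℕ) : ℝ) * (L : ℝ) ^ 2) * A)) := by
  refine (wtPinnedSum_le_of_pairTransfer hβ B Ω G hc hB j q y).trans ?_
  refine mul_le_mul_of_nonneg_left (mul_le_mul_of_nonneg_left ?_ (by positivity)) (pow_nonneg (imagTimeWeight_nonneg hβ M) 3)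
  exact sum_wt_norm_charSum_bump_le (P := 2 * M) G hs₀ hs₀1 hs₁ hs₁1 (t₀ := klScale klE0 j * β / (2 * M)) (t₁ := klScale klE0 j)
    hts₀ hts₁ hA hn₀ hNs hsupp hsup h₀ h₁

/-! ### §4 Superpositions -/

omit [NeZero L] [NeZero M] in
/-- **The weighted pinned sum of a superposition**: if `W Ω x = Σ_{i∈S} a_i·B_i Ω x + R Ω x` then for every weight `w ≥ 0` and every set `F` of tuples
`Σ_{x ∈ F} w x·‖W Ω x‖ ≤ Σ_i ‖a_i‖·Σ_{x ∈ F} w x·‖B_i Ω x‖ + Σ_{x ∈ F} w x·‖R Ω x‖`. [folklore] -/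
theorem wtPinnedSum_le_of_superposition {ι : Type*} {N m : ℕ} (S : Finset ι) (a : ι → ℂ)
    (W R : (Fin m → SectorLeg N) → (Fin m → SpaceTimeIdx L M) → ℂ) (B : ι → (Fin m → SectorLeg N) → (Fin m → SpaceTimeIdx L M) → ℂ)
    (Ω : Fin m → SectorLeg N) (hW : ∀ x, W Ω x = ∑ i ∈ S, a i * B i Ω x + R Ω x) (F : Finset (Fin m → SpaceTimeIdx L M))
    (w : (Fin m → SpaceTimeIdx L M) → ℝ) (hw : ∀ x, 0 ≤ w x) :
    ∑ x ∈ F, w x * ‖W Ω x‖ ≤ ∑ i ∈ S, ‖a i‖ * ∑ x ∈ F, w x * ‖B i Ω x‖ + ∑ x ∈ F, w x * ‖R Ω x‖ := by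
  have hpt : ∀ x, w x * ‖W Ω x‖ ≤ ∑ i ∈ S, ‖a i‖ * (w x * ‖B i Ω x‖) + w x * ‖R Ω x‖ := by
    intro x
    rw [hW]
    have h1 : ‖∑ i ∈ S, a i * B i Ω x + R Ω x‖ ≤ ∑ i ∈ S, ‖a i‖ * ‖B i Ω x‖ + ‖R Ω x‖ := by
      refine (norm_add_le _ _).trans (add_le_add ((norm_sum_le _ _).trans (le_of_eq ?_)) le_rfl)
      exact sum_congr rfl fun i _ => norm_mul _ _
    calc w x * ‖∑ i ∈ S, a i * B i Ω x + R Ω x‖ ≤ w x * (∑ i ∈ S, ‖a i‖ * ‖B i Ω x‖ + ‖R Ω x‖) :=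
          mul_le_mul_of_nonneg_left h1 (hw x)
      _ = _ := by rw [mul_add, mul_sum]; congr 1; exact sum_congr rfl fun i _ => by ring
  calc ∑ x ∈ F, w x * ‖W Ω x‖ ≤ ∑ x ∈ F, (∑ i ∈ S, ‖a i‖ * (w x * ‖B i Ω x‖) + w x * ‖R Ω x‖) := sum_le_sum fun x _ => hpt x
    _ = _ := by
        rw [sum_add_distrib, sum_comm]
        congr 1
        exact sum_congr rfl fun i _ => by rw [mul_sum]

/-- **The weighted four-leg pinned sum of a superposition of pair-transfer bumps finer than the weight is paid by the `ℓ¹` sum of the amplitudes**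
(every pinned leg): `W Ω x = Σ_{i∈S} a_i·B_i Ω x + R Ω x`, every `B_i` majorised by a pair-transfer form of a bump `G_i` as in `wtPinnedSum_le_of_pairTransfer_bump`
⇒ `ε³·Σ_{x : x q = y} klScaleWt_j(pos x)‖W Ω x‖ ≤ ε³·(2c)·√(6561988608·n₀)·(2M·L²)·Σ_i ‖a_i‖·A_i + ε³·Σ_{x : x q = y} klScaleWt_j(pos x)‖R Ω x‖`.
[cite: BenfattoGiulianiMastropietro2006, §2.8 (2.81), §3 (3.65)] -/
theorem wtPinnedSum_le_of_pairTransfer_superposition {ι : Type*} {N : ℕ} {β : ℝ} (hβ : 0 ≤ β) (S : Finset ι) (a : ι → ℂ)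
    (W R : (Fin 4 → SectorLeg N) → (Fin 4 → SpaceTimeIdx L M) → ℂ) (B : ι → (Fin 4 → SectorLeg N) → (Fin 4 → SpaceTimeIdx L M) → ℂ)
    (Ω : Fin 4 → SectorLeg N) (hW : ∀ x, W Ω x = ∑ i ∈ S, a i * B i Ω x + R Ω x)
    (G : ι → TorusSite 1 (2 * M) × TorusSite 2 L → ℂ) {c : ℝ} (hc : 0 ≤ c)
    (hB : ∀ i ∈ S, ∀ x : Fin 4 → SpaceTimeIdx L M, ‖B i Ω x‖ ≤
      if x 1 = x 0 ∧ x 3 = x 2 then c * ‖∑ q : TorusSite 1 (2 * M) × TorusSite 2 L,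
        (torusChar q.1 (fun _ : Fin 1 => (((x 0).1 : ℕ) : ZMod (2 * M)) - (((x 2).1 : ℕ) : ZMod (2 * M))) *
          torusChar q.2 ((x 0).2 - (x 2).2)) • G i q‖ else 0)
    (j : ℕ) (s₀ s₁ A : ι → ℝ) (Ns : ι → ℕ) {n₀ : ℝ} (hn₀ : 0 ≤ n₀)
    (hs₀ : ∀ i ∈ S, 0 < s₀ i) (hs₀1 : ∀ i ∈ S, s₀ i ≤ 1) (hs₁ : ∀ i ∈ S, 0 < s₁ i) (hs₁1 : ∀ i ∈ S, s₁ i ≤ 1)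
    (hts₀ : ∀ i ∈ S, klScale klE0 j * β / (2 * M) ≤ s₀ i) (hts₁ : ∀ i ∈ S, klScale klE0 j ≤ s₁ i)
    (hA : ∀ i ∈ S, 0 ≤ A i) (hNs : ∀ i ∈ S, (Ns i : ℝ) ≤ n₀ * (s₀ i * (2 * M : ℕ)) * (s₁ i * L) ^ 2)
    (hsupp : ∀ i ∈ S, (univ.filter fun q => G i q ≠ 0).card ≤ Ns i) (hsup : ∀ i ∈ S, ∀ q, ‖G i q‖ ≤ A i)
    (h₀ : ∀ i ∈ S, ∀ q, ‖(fwdDiff ((fun _ : Fin 1 => (1 : ZMod (2 * M))), (0 : TorusSite 2 L)))^[3] (G i) q‖ ≤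
      A i * (4 / (s₀ i * (2 * M : ℕ))) ^ 3)
    (h₁ : ∀ i ∈ S, ∀ q (k : Fin 2), ‖(fwdDiff ((0 : TorusSite 1 (2 * M)), (Pi.single k (1 : ZMod L) : TorusSite 2 L)))^[3] (G i) q‖ ≤
      A i * (4 / (s₁ i * L)) ^ 3) (q : Fin 4) (y : SpaceTimeIdx L M) :
    imagTimeWeight β M ^ 3 *
        ∑ x ∈ univ.filter (fun x : Fin 4 → SpaceTimeIdx L M => x q = y),
          klScaleWt L M β j ((univ.image x).image (fun x : SpaceTimeIdx L M => (((((2 * (x.1 : ℕ) : ℕ)) : ZMod (2 * (2 * M)))), x.2))) *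
            ‖W Ω x‖ ≤
      imagTimeWeight β M ^ 3 * (2 * c * (Real.sqrt (6561988608 * n₀) * (((2 * M : ℕ) : ℝ) * (L : ℝ) ^ 2))) * ∑ i ∈ S, ‖a i‖ * A i +
        imagTimeWeight β M ^ 3 *
          ∑ x ∈ univ.filter (fun x : Fin 4 → SpaceTimeIdx L M => x q = y),
            klScaleWt L M β j ((univ.image x).image (fun x : SpaceTimeIdx L M => (((((2 * (x.1 : ℕ) : ℕ)) : ZMod (2 * (2 * M)))), x.2))) *
              ‖R Ω x‖ := by
  have hε : 0 ≤ imagTimeWeight β M ^ 3 := pow_nonneg (imagTimeWeight_nonneg hβ M) 3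
  set wt : (Fin 4 → SpaceTimeIdx L M) → ℝ := fun x =>
    klScaleWt L M β j ((univ.image x).image (fun x : SpaceTimeIdx L M => (((((2 * (x.1 : ℕ) : ℕ)) : ZMod (2 * (2 * M)))), x.2))) with hwt
  set F := univ.filter (fun x : Fin 4 → SpaceTimeIdx L M => x q = y) with hF
  have hsup' := wtPinnedSum_le_of_superposition S a W R B Ω hW F wt (fun x => zero_le_one.trans (one_le_klScaleWt L M β j _))
  have hb : ∀ i ∈ S, imagTimeWeight β M ^ 3 * ∑ x ∈ F, wt x * ‖B i Ω x‖ ≤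
      imagTimeWeight β M ^ 3 * (2 * c * (Real.sqrt (6561988608 * n₀) * (((2 * M : ℕ) : ℝ) * (L : ℝ) ^ 2) * A i)) := fun i hi =>
    wtPinnedSum_le_of_pairTransfer_bump hβ (B i) Ω (G i) hc (hB i hi) j (hs₀ i hi) (hs₀1 i hi) (hs₁ i hi) (hs₁1 i hi)
      (hts₀ i hi) (hts₁ i hi) (hA i hi) hn₀ (hNs i hi) (hsupp i hi) (hsup i hi) (h₀ i hi) (h₁ i hi) q y
  calc imagTimeWeight β M ^ 3 * ∑ x ∈ F, wt x * ‖W Ω x‖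
      ≤ imagTimeWeight β M ^ 3 * (∑ i ∈ S, ‖a i‖ * ∑ x ∈ F, wt x * ‖B i Ω x‖ + ∑ x ∈ F, wt x * ‖R Ω x‖) :=
        mul_le_mul_of_nonneg_left hsup' hε
    _ = ∑ i ∈ S, ‖a i‖ * (imagTimeWeight β M ^ 3 * ∑ x ∈ F, wt x * ‖B i Ω x‖) + imagTimeWeight β M ^ 3 * ∑ x ∈ F, wt x * ‖R Ω x‖ := by
        rw [mul_add, mul_sum]
        congr 1
        exact sum_congr rfl fun i _ => by ring
    _ ≤ ∑ i ∈ S, ‖a i‖ * (imagTimeWeight β M ^ 3 * (2 * c * (Real.sqrt (6561988608 * n₀) * (((2 * M : ℕ) : ℝ) * (L : ℝ) ^ 2) * A i))) +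
          imagTimeWeight β M ^ 3 * ∑ x ∈ F, wt x * ‖R Ω x‖ :=
        add_le_add (sum_le_sum fun i hi => mul_le_mul_of_nonneg_left (hb i hi) (norm_nonneg _)) le_rfl
    _ = _ := by
        have hfin : ∑ i ∈ S, ‖a i‖ * (imagTimeWeight β M ^ 3 * (2 * c * (Real.sqrt (6561988608 * n₀) * (((2 * M : ℕ) : ℝ) * (L : ℝ) ^ 2) * A i))) =
            imagTimeWeight β M ^ 3 * (2 * c * (Real.sqrt (6561988608 * n₀) * (((2 * M : ℕ) : ℝ) * (L : ℝ) ^ 2))) * ∑ i ∈ S, ‖a i‖ * A i := by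
          rw [Finset.mul_sum]
          exact sum_congr rfl fun i _ => by ring
        rw [hfin]

/-! ### §5 The cell / import shape -/

/-- **THE WEIGHTED FOUR-LEG CELL / IMPORT SHAPE** («weighted plain four-leg line from a pair-transfer dyadic representation finer than the weight + a
total-variation law»): let `𝒱` be any Grassmann element whose trivial-family quartic position kernel is, for EVERY label tuple `τ′`, a superposition
`Σ_{i∈S} a_i·B_i + R` of pair-transfer bumps as in `wtPinnedSum_le_of_pairTransfer_superposition` (scales `i` with rates above the weight's:
`Λ_jβ/(2M) ≤ s₀ⁱ`, `Λ_j ≤ s₁ⁱ`), with `Σ_{i∈S}‖a_i‖·A_i ≤ V`, weighted remainder pinned sums `≤ r` at every leg and pin, and `ε³·(2c)·(2M·L²) ≤ κ`.  Then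
`∀ q τ′ y′, ε³·Σ_{x′ : x′ q = y′} klScaleWt_j(pos x′)·‖sectorisedKernel … trivialMultiplier 𝒱 4 τ′ x′‖ ≤ κ·√(6561988608·n₀)·V + r` — the `S₄ j`-cell of the weighted
assemblies (W12♯3 ll.185–191) and the `s₄` import binder of the weighted tower, from the SAME data as the (X).1 plain line ((T2) p704772).
[cite: BenfattoGiulianiMastropietro2006, §2.8 (2.81), §3 (3.65)] -/
theorem wplainFourLegLine_of_pairTransfer_superposition {ι : Type*} {β : ℝ} (hβ : 0 ≤ β) (𝒱 : HubbardGrassmann L M)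
    (S : Finset ι) (a : (Fin 4 → SectorLeg 1) → ι → ℂ)
    (B : (Fin 4 → SectorLeg 1) → ι → (Fin 4 → SectorLeg 1) → (Fin 4 → SpaceTimeIdx L M) → ℂ)
    (R : (Fin 4 → SectorLeg 1) → (Fin 4 → SectorLeg 1) → (Fin 4 → SpaceTimeIdx L M) → ℂ)
    (G : (Fin 4 → SectorLeg 1) → ι → TorusSite 1 (2 * M) × TorusSite 2 L → ℂ) {c : ℝ} (hc : 0 ≤ c) (j : ℕ)
    (s₀ s₁ A : (Fin 4 → SectorLeg 1) → ι → ℝ) (Ns : (Fin 4 → SectorLeg 1) → ι → ℕ) {n₀ V r κ : ℝ} (hn₀ : 0 ≤ n₀)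
    (hW : ∀ (τ : Fin 4 → SectorLeg 1) (x : Fin 4 → SpaceTimeIdx L M),
      sectorisedKernel L M β (trivialMultiplier L M) 𝒱 4 τ x = ∑ i ∈ S, a τ i * B τ i τ x + R τ τ x)
    (hB : ∀ (τ : Fin 4 → SectorLeg 1), ∀ i ∈ S, ∀ x : Fin 4 → SpaceTimeIdx L M, ‖B τ i τ x‖ ≤
      if x 1 = x 0 ∧ x 3 = x 2 then c * ‖∑ q : TorusSite 1 (2 * M) × TorusSite 2 L,
        (torusChar q.1 (fun _ : Fin 1 => (((x 0).1 : ℕ) : ZMod (2 * M)) - (((x 2).1 : ℕ) : ZMod (2 * M))) *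
          torusChar q.2 ((x 0).2 - (x 2).2)) • G τ i q‖ else 0)
    (hs₀ : ∀ τ, ∀ i ∈ S, 0 < s₀ τ i) (hs₀1 : ∀ τ, ∀ i ∈ S, s₀ τ i ≤ 1) (hs₁ : ∀ τ, ∀ i ∈ S, 0 < s₁ τ i) (hs₁1 : ∀ τ, ∀ i ∈ S, s₁ τ i ≤ 1)
    (hts₀ : ∀ τ, ∀ i ∈ S, klScale klE0 j * β / (2 * M) ≤ s₀ τ i) (hts₁ : ∀ τ, ∀ i ∈ S, klScale klE0 j ≤ s₁ τ i)
    (hA : ∀ τ, ∀ i ∈ S, 0 ≤ A τ i) (hNs : ∀ τ, ∀ i ∈ S, (Ns τ i : ℝ) ≤ n₀ * (s₀ τ i * (2 * M : ℕ)) * (s₁ τ i * L) ^ 2)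
    (hsupp : ∀ τ, ∀ i ∈ S, (univ.filter fun q => G τ i q ≠ 0).card ≤ Ns τ i) (hsup : ∀ τ, ∀ i ∈ S, ∀ q, ‖G τ i q‖ ≤ A τ i)
    (h₀ : ∀ τ, ∀ i ∈ S, ∀ q, ‖(fwdDiff ((fun _ : Fin 1 => (1 : ZMod (2 * M))), (0 : TorusSite 2 L)))^[3] (G τ i) q‖ ≤
      A τ i * (4 / (s₀ τ i * (2 * M : ℕ))) ^ 3)
    (h₁ : ∀ τ, ∀ i ∈ S, ∀ q (k : Fin 2),
      ‖(fwdDiff ((0 : TorusSite 1 (2 * M)), (Pi.single k (1 : ZMod L) : TorusSite 2 L)))^[3] (G τ i) q‖ ≤ A τ i * (4 / (s₁ τ i * L)) ^ 3)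
    (hV : ∀ τ, ∑ i ∈ S, ‖a τ i‖ * A τ i ≤ V)
    (hr : ∀ (q : Fin 4) (τ : Fin 4 → SectorLeg 1) (y : SpaceTimeIdx L M),
      imagTimeWeight β M ^ 3 * ∑ x ∈ univ.filter (fun x : Fin 4 → SpaceTimeIdx L M => x q = y),
        klScaleWt L M β j ((univ.image x).image (fun x : SpaceTimeIdx L M => (((((2 * (x.1 : ℕ) : ℕ)) : ZMod (2 * (2 * M)))), x.2))) * ‖R τ τ x‖ ≤ r)
    (hκ : imagTimeWeight β M ^ 3 * (2 * c * (((2 * M : ℕ) : ℝ) * (L : ℝ) ^ 2)) ≤ κ) :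
    ∀ (q : Fin 4) (τ : Fin 4 → SectorLeg 1) (y : SpaceTimeIdx L M),
      imagTimeWeight β M ^ 3 * ∑ x ∈ univ.filter (fun x : Fin 4 → SpaceTimeIdx L M => x q = y),
        klScaleWt L M β j ((univ.image x).image (fun x : SpaceTimeIdx L M => (((((2 * (x.1 : ℕ) : ℕ)) : ZMod (2 * (2 * M)))), x.2))) *
          ‖sectorisedKernel L M β (trivialMultiplier L M) 𝒱 4 τ x‖ ≤
        κ * Real.sqrt (6561988608 * n₀) * V + r := by
  intro q τ y
  have h := wtPinnedSum_le_of_pairTransfer_superposition hβ S (a τ) (sectorisedKernel L M β (trivialMultiplier L M) 𝒱 4) (R τ) (B τ) τ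
    (hW τ) (G τ) hc (hB τ) j (s₀ τ) (s₁ τ) (A τ) (Ns τ) hn₀ (hs₀ τ) (hs₀1 τ) (hs₁ τ) (hs₁1 τ) (hts₀ τ) (hts₁ τ) (hA τ) (hNs τ)
    (hsupp τ) (hsup τ) (h₀ τ) (h₁ τ) q y
  refine h.trans (add_le_add ?_ (hr q τ y))
  have hsq : 0 ≤ Real.sqrt (6561988608 * n₀) := Real.sqrt_nonneg _
  have hVs : 0 ≤ ∑ i ∈ S, ‖a τ i‖ * A τ i := sum_nonneg fun i hi => mul_nonneg (norm_nonneg _) (hA τ i hi)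
  have hε : 0 ≤ imagTimeWeight β M ^ 3 * (2 * c * (((2 * M : ℕ) : ℝ) * (L : ℝ) ^ 2)) := by
    have := imagTimeWeight_nonneg hβ M; positivity
  calc imagTimeWeight β M ^ 3 * (2 * c * (Real.sqrt (6561988608 * n₀) * (((2 * M : ℕ) : ℝ) * (L : ℝ) ^ 2))) * ∑ i ∈ S, ‖a τ i‖ * A τ i
      = (imagTimeWeight β M ^ 3 * (2 * c * (((2 * M : ℕ) : ℝ) * (L : ℝ) ^ 2))) * Real.sqrt (6561988608 * n₀) *
          ∑ i ∈ S, ‖a τ i‖ * A τ i := by ring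
    _ ≤ κ * Real.sqrt (6561988608 * n₀) * V :=
        mul_le_mul (mul_le_mul_of_nonneg_right hκ hsq) (hV τ) hVs (mul_nonneg (hε.trans hκ) hsq)

end Summit.HubbardSuperconductivity.HubbardSuperconductivity.Theorems.EngineV8

end
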